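import Mathlib

/-!
# Federbush, *A phase cell approach to Yang–Mills theory* III — §1 «Pure Averages of Group Elements» (Lemmas 1.0–1.3),
# §5.1 «Preliminaries» (Lemmas 5.0–5.5) and §5.2 (Lemma 5.6, Parameter Conditions 5.7–5.8, Proposition 5.9):
# TYPED STATEMENTS with citation tags; Lemmas 5.0, 5.1, 5.3, 5.5 (algebraic core) and 5.6 (given the contour count) PROVED

statement-level skeleton of published theorems with citation tags; proofs where landed; nothing here is a claim about the Yang–Mills mass gap

Cell `lit-balaban` (mega-formalisation of Bałaban's lattice renormalisation-group papers and the pieces of Federbush's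
phase-cell series that Bałaban's papers or the `pub-balaban` T⁴ spine cite), reader/typer block **r17 = Federbush**;
SKELETON rows `F3-…` of `run/shared/lean/pub/lit-balaban/lit-balaban-r17/SKELETON-r17.md`.

**Source.** P. Federbush, *A phase cell approach to Yang–Mills theory. III. Local stability, modified renormalization
group transformation*, Commun. Math. Phys. **110** (1987) 293–309 [bib `Federbush1987PhaseCellIII`]; journal page =
PDF page + 292.  Pages READ AS IMAGES by this seat: p. 294–295 (§1, Lemmas 1.0–1.3, (1.1)–(1.12)), p. 299 (§5.1,
Lemmas 5.0–5.3, (5.1)–(5.6)), p. 300 (Lemma 5.4, (5.7)–(5.11)), p. 301 (Lemma 5.5 (5.12), §5.2, Lemma 5.6 (5.13),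
Parameter Conditions 5.7 (5.14) and 5.8 (5.15), Proposition 5.9 (5.16)), p. 302 (first line) — Project-Euclid scan
`run/shared/lean/pub/pub-balaban/t4/b2b-balaban-t4-lit2/pdf/fed1987-cmp110-III.pdf`, renders
`…/b2b-balaban-t4-lit2/renders/fed1987III/fed1987-cmp110-III-p007-x2.png` and this seat's
`renders/fedIII/fed1987-cmp110-III-p003|p008|p009-x2.png`.

**Why these statements are in the corpus.** Bałaban, CMP **109** (1987) p. 253 [`Balaban1987RG1`] defines his group
average by «a definition which is equivalent to the one given by Federbush in [35]. The average of the set {U_j} is the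
element U ∈ Gᶜ such that U_j are in a small neighborhood of U, and it satisfies the equation Σ_{j=1}^n (1/i) log U_j U⁻¹
= 0. (0.10) This definition has all the properties listed above, as it was proved by Federbush in [35 (II)].», where
[35] = «Federbusch, P.: A phase cell approach to Yang–Mills theory. I. Small field modes. II. Stability, modified
renormalization group transformations. University of Michigan preprints» — the preprint «II» is THIS paper (published as
part III, same subtitle).  Lemma 1.3 below is the printed statement behind (0.10) (the minimiser `e^x` of (1.2) has
`x = 0` iff `Σ A_i = 0`; by invariance of `d`, `isPureAverage_iff_conj` below, the average `ḡ` of `{g_i}` is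
characterised by `1` being the average of `{ḡ⁻¹ g_i}`).  The tree's
`Balaban1983to89/BlockAveragingFederbush{,B7,GValued,Analytic,Radius,RadiusExact}` CONSTRUCT and analyse the solution of
(0.10) on complete normed algebras / `U(N)`, `SU(N)` (operator norm, series logarithm); this file does not import or
restate them — it types what Federbush prints, in Federbush's setting (an invariant distance `d` on the group, elements
`e^A` with `|A|` small), and is the citable anchor for the SKELETON rows.

**Setting, verbatim (p. 294–295).** «We let G be a compact Lie Group and d(·,·) an invariant distance constructed from
an invariant metric on G. ε will denote the identity, and we consider elements g = e^A that are sufficiently close to the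
identity, with |A| sufficiently small. For a collection of such elements {g_i = e^{A_i}}_{i=1,…,n}, we define an average
ḡ,  ḡ = e^x = \overline{(g_i)}  (1.1)  as the element minimizing the expression  Σ_{i=1}^n d²(ḡ, g_i).  (1.2)»;
p. 299: «We define |g| = d(ε, g).»

**How the setting is typed (abstraction note for the referee, F6).** The group is a type `G` with `[Group G]`, a
distance `[MetricSpace G]`, and the printed «invariant distance» = the two Mathlib classes `[IsIsometricSMul G G]`
(left invariance `d(kg, kh) = d(g, h)`) and `[IsIsometricSMul Gᵐᵒᵖ G]` (right invariance); compactness and the Lie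
structure are NOT used by any statement below and are not assumed.  The Lie algebra is a real normed space `𝔤`
(`|A|² = −Tr(A²)` of (1.3) is its norm squared) and the exponential is a bare map `exp : 𝔤 → G` passed as a parameter;
«sufficiently close to the identity / |A| sufficiently small» is an explicit radius (`∃ ρ > 0, ∀ A, ‖A‖ < ρ → …`).  The
printed average «the element minimizing (1.2)» presupposes existence and uniqueness for close elements; here
`IsPureAverage gs ḡ` is the PREDICATE «ḡ minimises (1.2)», and every statement quantifies over minimisers (nothing is
asserted about existence or uniqueness).  Lemma 5.4/5.5's lattice-contour bookkeeping (holonomies of two contours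
differing by one plaquette are `a·s·b` and `a·(g_{∂p}·s)·b`) is the hypothesis `hstep` of `dist_chain_le` — the printed
geometric clause lives there, the metric inequality is proved.

**What is PROVED here (kernel, Mathlib only):** Lemma 5.0 (5.1) `abs_mul_inv`, Lemma 5.1 (5.2) `abs_mul_le` (the
printed two-line proof (5.3)–(5.4)), Lemma 5.3 (5.6) `abs_inv`, conjugation invariance `abs_conj`, the one-homotopy
identity `dist_homotopy_step` and Lemma 5.5 (5.12) in chain form `dist_chain_le`, Lemma 5.6 (5.13) given the printed
contour count `dist_le_of_chain_count`, the invariance step (1.6) `isPureAverage_iff_conj`, and Lemma 5.2 (5.5)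
`abs_exp_le_norm` from Lemma 1.0 + the one-parameter-subgroup property of `exp` (the printed proof «from Lemma 5.1 and
Lemma 1.0»).  **What is TYPED ONLY (`def … : Prop`, proof deferred to Phase 2):** Lemma 1.0 (as the normalisation
hypothesis it is), Lemma 1.1 (1.4)–(1.5) with (1.11), Lemma 1.2 (1.10), Lemma 1.3, Proposition 5.9 (5.16); Parameter
Conditions 5.7–5.8 are plain definitions.  Nothing printed is weakened; readings forced on us by undisplayed dependences
are flagged `READING:` in the docstrings.
-/

namespace Literature.MathematicalPhysics.QuantumFieldTheory.Federbush1986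

open scoped BigOperators

/-! ## §5.1 — the size `|g| = d(ε, g)` and Lemmas 5.0–5.3 (p. 299) -/

section Metric

variable {G : Type*} [Group G] [MetricSpace G]

/-- «We define |g| = d(ε, g).» — the distance to the identity. [cite: Federbush1987PhaseCellIII, §5.1 p. 299] -/
def absG (g : G) : ℝ := dist 1 g

/-- Unfolding `|g| = d(ε, g)`. [cite: Federbush1987PhaseCellIII, §5.1 p. 299] -/
theorem absG_def (g : G) : absG g = dist 1 g := rfl

/-- `|ε| = 0`. [cite: Federbush1987PhaseCellIII, §5.1 p. 299] -/
@[simp] theorem absG_one : absG (1 : G) = 0 := by simp [absG]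

/-- `|g| ≥ 0`. [cite: Federbush1987PhaseCellIII, §5.1 p. 299] -/
theorem absG_nonneg (g : G) : 0 ≤ absG g := dist_nonneg

variable [IsIsometricSMul G G] [IsIsometricSMul Gᵐᵒᵖ G]

omit [IsIsometricSMul G G] in
/-- **Lemma 5.0** «|g₁g₂⁻¹| = d(g₁, g₂) (5.1) by invariance of the metric.» — PROVED (right invariance).
[cite: Federbush1987PhaseCellIII, Lemma 5.0 (5.1) p. 299] -/
theorem abs_mul_inv (g₁ g₂ : G) : absG (g₁ * g₂⁻¹) = dist g₁ g₂ := by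
  unfold absG
  have h := dist_mul_right (1 : G) (g₁ * g₂⁻¹) g₂
  rw [one_mul, inv_mul_cancel_right] at h
  rw [← h, dist_comm]

omit [IsIsometricSMul Gᵐᵒᵖ G] in
/-- **Lemma 5.1** «|g₁g₂| ≤ |g₁| + |g₂| (5.2). Proof. d(ε, g₁g₂) ≤ d(ε, g₁) + d(g₁, g₁g₂) ≤ d(ε, g₁) + d(ε, g₂), (5.3)
since d(g₁, g₁g₂) = d(ε, g₂) (5.4) by invariance of the metric.» — PROVED, the printed proof (left invariance).
[cite: Federbush1987PhaseCellIII, Lemma 5.1 (5.2)–(5.4) p. 299] -/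
theorem abs_mul_le (g₁ g₂ : G) : absG (g₁ * g₂) ≤ absG g₁ + absG g₂ := by
  unfold absG
  have h54 : dist g₁ (g₁ * g₂) = dist 1 g₂ := by
    have := dist_mul_left g₁ (1 : G) g₂
    rwa [mul_one] at this
  calc dist 1 (g₁ * g₂) ≤ dist 1 g₁ + dist g₁ (g₁ * g₂) := dist_triangle _ _ _
    _ = dist 1 g₁ + dist 1 g₂ := by rw [h54]

/-- **Lemma 5.3** «|g| = |g⁻¹| (5.6). Proof. This follows since g → g⁻¹ is an isometric mapping.» — PROVED.
[cite: Federbush1987PhaseCellIII, Lemma 5.3 (5.6) p. 299] -/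
theorem abs_inv (g : G) : absG g⁻¹ = absG g := by
  unfold absG
  have := dist_inv_inv (1 : G) g
  rwa [inv_one] at this

/-- Conjugation invariance `|u g u⁻¹| = |g|` (both invariances); used for the base-point independence of `|g_{∂p}|` in
Lemmas 5.4–5.5. [cite: Federbush1987PhaseCellIII, §5.1 p. 299–300] -/
theorem abs_conj (u g : G) : absG (u * g * u⁻¹) = absG g := by
  unfold absG
  have h1 := dist_mul_left u (1 * u⁻¹) (g * u⁻¹)
  have h2 := dist_mul_right (1 : G) g u⁻¹
  rw [one_mul, mul_inv_cancel] at h1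
  rw [one_mul] at h2
  rw [← mul_assoc] at h1
  rw [h1, h2]

/-- The one-step identity behind Lemmas 5.4–5.5: if two contours differ by an elementary homotopy across a plaquette
`p`, their group elements are `a·s·b` and `a·(g·s)·b` with `g` the plaquette variable based at the start of the
replaced arc, and then `d(g_{Γ₁}, g_{Γ₂}) = |g|` — PROVED (bi-invariance).  The identification of the two holonomies
with `a·s·b`, `a·(g·s)·b` is the printed lattice bookkeeping ((5.9)–(5.11), Fig. 6–8), carried as the hypothesis of
`dist_chain_le`. [cite: Federbush1987PhaseCellIII, (5.9)–(5.11) p. 300, Lemma 5.5 p. 301] -/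
theorem dist_homotopy_step (a s b g : G) : dist (a * s * b) (a * (g * s) * b) = absG g := by
  unfold absG
  rw [dist_mul_right, dist_mul_left]
  have := dist_mul_right (1 : G) g s
  rwa [one_mul] at this

/-- **Lemma 5.5** (chain form) «If Γ₁ and Γ₂ are connected by a sequence of elementary homotopies provided by
plaquettes p₁, p₂, …, p_n, then d(g_{Γ₁}, g_{Γ₂}) ≤ Σ_{i=1}^n |g_{∂p_i}|. (5.12) The proof is direct. Note that Lemma 5.5
includes Lemma 5.4.» — PROVED for a chain `g 0, …, g n` of group elements in which consecutive terms are related by one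
elementary homotopy with plaquette variable `p k` (hypothesis `hstep`, see `dist_homotopy_step`).  Lemma 5.4 (5.7)–(5.8)
(`|g_{∂R}| ≤ Σ_{i∈R} |g_{∂p_i}|` for a rectangle `R = Σ p_i`) is the case `g 0 = 1`-based closed contour, included as
print says. [cite: Federbush1987PhaseCellIII, Lemma 5.5 (5.12) p. 301; Lemma 5.4 (5.7)–(5.8) p. 300] -/
theorem dist_chain_le (n : ℕ) (g : ℕ → G) (p : ℕ → G)
    (hstep : ∀ k < n, ∃ a s b : G, g k = a * s * b ∧ g (k + 1) = a * (p k * s) * b) :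
    dist (g 0) (g n) ≤ ∑ k ∈ Finset.range n, absG (p k) := by
  induction n with
  | zero => simp
  | succ n ih =>
    have hprev : ∀ k < n, ∃ a s b : G, g k = a * s * b ∧ g (k + 1) = a * (p k * s) * b :=
      fun k hk => hstep k (Nat.lt_succ_of_lt hk)
    obtain ⟨a, s, b, hk, hk1⟩ := hstep n (Nat.lt_succ_self n)
    have hlast : dist (g n) (g (n + 1)) = absG (p n) := by rw [hk, hk1, dist_homotopy_step]
    calc dist (g 0) (g (n + 1)) ≤ dist (g 0) (g n) + dist (g n) (g (n + 1)) := dist_triangle _ _ _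
      _ ≤ (∑ k ∈ Finset.range n, absG (p k)) + absG (p n) := by rw [hlast]; exact add_le_add (ih hprev) le_rfl
      _ = ∑ k ∈ Finset.range (n + 1), absG (p k) := by rw [Finset.sum_range_succ]

/-- **Lemma 5.6** (metric part) «Let Γ₁ and Γ₂ be two contours whose associated group elements are averaged (along
with N⁴ − 2 others) to yield a group assignment to a bond of P. Assume all p_i are s.f. Then d(g_{Γ₁}, g_{Γ₂}) ≤
8(N − 1)Na. (5.13)» — PROVED in the form: a chain of at most `M` elementary homotopies through plaquettes with
`|g_{∂p}| < a` (s.f., §4 p. 298) moves the holonomy by `≤ M·a`.  The printed COUNT `M = 8(N − 1)N` («any two contours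
are related by ≤ 8(N − 1)N elementary homotopies», p. 301, for the contours Γ_{c₋,x} of Bałaban's (1.8) of CMP 95) is
lattice geometry NOT formalised here: it is the hypothesis `hn`. [cite: Federbush1987PhaseCellIII, Lemma 5.6 (5.13)
p. 301] -/
theorem dist_le_of_chain_count (n M : ℕ) (a : ℝ) (g : ℕ → G) (p : ℕ → G)
    (hstep : ∀ k < n, ∃ a' s b : G, g k = a' * s * b ∧ g (k + 1) = a' * (p k * s) * b)
    (hsf : ∀ k < n, absG (p k) < a) (hn : n ≤ M) (ha : 0 ≤ a) :
    dist (g 0) (g n) ≤ M * a := by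
  have h1 := dist_chain_le n g p hstep
  have h2 : ∑ k ∈ Finset.range n, absG (p k) ≤ ∑ _k ∈ Finset.range n, a :=
    Finset.sum_le_sum fun k hk => le_of_lt (hsf k (Finset.mem_range.mp hk))
  rw [Finset.sum_const, Finset.card_range, nsmul_eq_mul] at h2
  calc dist (g 0) (g n) ≤ n * a := le_trans h1 h2
    _ ≤ M * a := by exact mul_le_mul_of_nonneg_right (by exact_mod_cast hn) ha

end Metric

/-! ## §1 — the pure average (1.1)–(1.2) and Lemmas 1.0–1.3 (p. 294–296) -/

section Average

variable {G : Type*} [MetricSpace G]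

/-- The functional (1.2) «Σ_{i=1}^n d²(ḡ, g_i)» as a function of the candidate `h`.
[cite: Federbush1987PhaseCellIII, (1.2) p. 295] -/
def sumSqDist {n : ℕ} (gs : Fin n → G) (h : G) : ℝ := ∑ i, dist h (gs i) ^ 2

/-- Unfolding (1.2). [cite: Federbush1987PhaseCellIII, (1.2) p. 295] -/
theorem sumSqDist_def {n : ℕ} (gs : Fin n → G) (h : G) : sumSqDist gs h = ∑ i, dist h (gs i) ^ 2 := rfl

/-- «we define an average ḡ = e^x = \overline{(g_i)} (1.1) as the element minimizing the expression Σ_{i=1}^n d²(ḡ, g_i).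
(1.2)» — the PREDICATE «ḡ minimises (1.2)» (the pure average of group elements; print presupposes a unique minimiser
for elements close together — not asserted).  By VI p. 19 this «yields "Balaban averaging." (This definition actually
differs slightly from that used originally by Balaban.)»; by Bałaban CMP 109 p. 253 it is «equivalent to» (0.10) there.
[cite: Federbush1987PhaseCellIII, (1.1)–(1.2) p. 294–295] -/
def IsPureAverage {n : ℕ} (gs : Fin n → G) (gbar : G) : Prop := ∀ h : G, sumSqDist gs gbar ≤ sumSqDist gs h

/-- Unfolding the minimiser predicate (1.1)–(1.2). [cite: Federbush1987PhaseCellIII, (1.1)–(1.2) p. 294–295] -/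
theorem isPureAverage_def {n : ℕ} (gs : Fin n → G) (gbar : G) :
    IsPureAverage gs gbar ↔ ∀ h : G, sumSqDist gs gbar ≤ sumSqDist gs h := Iff.rfl

variable [Group G] [IsIsometricSMul G G]

/-- The invariance step (1.6) «d²(e^A, e^B) = d²(ε, e^{−A}e^B)» at the level of the average: `ḡ` is the pure average
of `{g_i}` iff `u·ḡ` is the pure average of `{u·g_i}` — PROVED (left invariance).  With `u = ḡ⁻¹` this is the
reduction «ḡ = avg{g_i} ⇔ ε = avg{ḡ⁻¹g_i}» which, combined with Lemma 1.3, gives Bałaban's (0.10)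
`Σ_i log(ḡ⁻¹ g_i) = 0` [Balaban1987RG1 p. 253]. [cite: Federbush1987PhaseCellIII, (1.6) p. 295] -/
theorem isPureAverage_iff_conj {n : ℕ} (gs : Fin n → G) (gbar u : G) :
    IsPureAverage gs gbar ↔ IsPureAverage (fun i => u * gs i) (u * gbar) := by
  have key : ∀ h : G, sumSqDist (fun i => u * gs i) (u * h) = sumSqDist gs h := by
    intro h; simp [sumSqDist, dist_mul_left]
  constructor
  · intro H h
    have := H (u⁻¹ * h)
    rw [← key gbar, ← key (u⁻¹ * h), mul_inv_cancel_left] at this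
    exact this
  · intro H h
    have := H (u * h)
    rwa [key, key] at this

/-- Corollary: `ḡ` is the pure average of `{g_i}` iff `1` is the pure average of `{ḡ⁻¹ g_i}`.
[cite: Federbush1987PhaseCellIII, (1.6) p. 295] -/
theorem isPureAverage_iff_one {n : ℕ} (gs : Fin n → G) (gbar : G) :
    IsPureAverage gs gbar ↔ IsPureAverage (fun i => gbar⁻¹ * gs i) 1 := by
  have := isPureAverage_iff_conj gs gbar gbar⁻¹
  rwa [inv_mul_cancel] at this

end Average

section LieData

variable {G : Type*} [Group G] [MetricSpace G]
variable {𝔤 : Type*} [NormedAddCommGroup 𝔤] [NormedSpace ℝ 𝔤]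

/-- **Lemma 1.0** «We may normalize d to satisfy d²(ε, e^A) = A² ≡ −Tr(A²) ≡ |A|². (1.3) (Note the definition of A², for
A in the Lie Algebra.)» — for «elements g = e^A that are sufficiently close to the identity, with |A| sufficiently small»
(p. 294).  TYPED as the normalisation property of the data `(d, ‖·‖, exp)` on the radius `ρ`: `d(ε, e^A) = |A|` for
`|A| < ρ` (squares dropped, both sides ≥ 0).  It is a hypothesis of the later statements, exactly as print uses it.
[cite: Federbush1987PhaseCellIII, Lemma 1.0 (1.3) p. 295] -/
def Lemma10Normalisation (exp : 𝔤 → G) (ρ : ℝ) : Prop := ∀ A : 𝔤, ‖A‖ < ρ → absG (exp A) = ‖A‖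

/-- **Lemma 1.1** «d²(e^A, e^B) = (B − A)² + F, (1.4) where |F| ≤ c(|B|⁴ + |A|⁴). (1.5)» (sketch of proof by (1.6)–(1.9):
invariance, Baker–Campbell–Hausdorff, `Tr(M[M, N]) = 0`), together with the derivative form (1.11) «|dF/dy| ≤ c(|B|³ +
|A|³)» («with y a component of A», «by the same arguments»).  TYPED: for `A, B` in a ball `‖·‖ < ρ` («sufficiently close
to the identity»), with ONE constant `c`; (1.11) is typed with the Fréchet derivative in `A` of
`F(A, B) = d²(e^A, e^B) − |B − A|²` (operator norm ≤ c(|B|³ + |A|³) bounds every component derivative).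
[cite: Federbush1987PhaseCellIII, Lemma 1.1 (1.4)–(1.5), (1.11) p. 295] -/
def Lemma11 (exp : 𝔤 → G) : Prop :=
  ∃ ρ > (0 : ℝ), ∃ c : ℝ, ∀ A B : 𝔤, ‖A‖ < ρ → ‖B‖ < ρ →
    |dist (exp A) (exp B) ^ 2 - ‖B - A‖ ^ 2| ≤ c * (‖B‖ ^ 4 + ‖A‖ ^ 4) ∧
    DifferentiableAt ℝ (fun A' : 𝔤 => dist (exp A') (exp B) ^ 2 - ‖B - A'‖ ^ 2) A ∧
    ‖fderiv ℝ (fun A' : 𝔤 => dist (exp A') (exp B) ^ 2 - ‖B - A'‖ ^ 2) A‖ ≤ c * (‖B‖ ^ 3 + ‖A‖ ^ 3)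

/-- **Lemma 1.2** «With the notation above x = (1/n) Σ A_i + (1/n) Σ T_i (1.10) with |T_i| ≤ c(|x|³ + |A_i|³).» — here
`e^x = ḡ` is the pure average (1.1)–(1.2) of `g_i = e^{A_i}`, `i = 1, …, n` (so `n ≥ 1`), all `|A_i|`, `|x|` small; «This
result is obtained by differentiating (1.2) with respect to (components of) x.»  TYPED over minimisers (`IsPureAverage`).
READING: print does not display on what `c` depends; it is used in §5.2 b)–c) with `n = N⁴` and `N` taken large
afterwards, so `c` is typed INDEPENDENT of `n` (chosen before `n`). [cite: Federbush1987PhaseCellIII, Lemma 1.2 (1.10)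
p. 295] -/
def Lemma12 (exp : 𝔤 → G) : Prop :=
  ∃ ρ > (0 : ℝ), ∃ c : ℝ, ∀ (n : ℕ), 0 < n → ∀ (A : Fin n → 𝔤) (x : 𝔤),
    (∀ i, ‖A i‖ < ρ) → ‖x‖ < ρ → IsPureAverage (fun i => exp (A i)) (exp x) →
      ∃ T : Fin n → 𝔤, x = (n : ℝ)⁻¹ • ∑ i, A i + (n : ℝ)⁻¹ • ∑ i, T i ∧
        ∀ i, ‖T i‖ ≤ c * (‖x‖ ^ 3 + ‖A i‖ ^ 3)

/-- **Lemma 1.3** «x = 0 ⇔ Σ A_i = 0.» («This surprising result follows by noting that Σ_i d²(e^x, e^{A_i}) =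
Σ_i (x − A_i)² + E, (1.12) where E is a power series with non-zero powers of x all ≥ 2. Again the Baker–Campbell–
Hausdorff formula and Eq. (1.9) yield this property.») — `e^x` the pure average of `{e^{A_i}}_{i=1..n}`, all small.
This is the statement Bałaban CMP 109 p. 253 invokes for (0.10) («as it was proved by Federbush in [35 (II)]»): with
`isPureAverage_iff_one`, the average `ḡ` of `{g_i}` satisfies `Σ_i log(ḡ⁻¹ g_i) = 0`.
[cite: Federbush1987PhaseCellIII, Lemma 1.3 with (1.12) p. 295–296] -/
def Lemma13 (exp : 𝔤 → G) : Prop :=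
  ∃ ρ > (0 : ℝ), ∀ (n : ℕ), 0 < n → ∀ (A : Fin n → 𝔤) (x : 𝔤),
    (∀ i, ‖A i‖ < ρ) → ‖x‖ < ρ → IsPureAverage (fun i => exp (A i)) (exp x) →
      (x = 0 ↔ ∑ i, A i = 0)

variable [IsIsometricSMul G G] [IsIsometricSMul Gᵐᵒᵖ G]

omit [IsIsometricSMul Gᵐᵒᵖ G] in
/-- Powers stay within `m·|g|`: `|g^m| ≤ m|g|`, by Lemma 5.1 — the induction inside the proof of Lemma 5.2.
[cite: Federbush1987PhaseCellIII, Lemma 5.1 (5.2), Lemma 5.2 p. 299] -/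
theorem abs_pow_le (g : G) (m : ℕ) : absG (g ^ m) ≤ m * absG g := by
  induction m with
  | zero => simp
  | succ m ih =>
    rw [pow_succ]
    calc absG (g ^ m * g) ≤ absG (g ^ m) + absG g := abs_mul_le _ _
      _ ≤ m * absG g + absG g := add_le_add ih le_rfl
      _ = (m + 1 : ℕ) * absG g := by push_cast; ring

omit [IsIsometricSMul Gᵐᵒᵖ G] in
/-- **Lemma 5.2** «|e^A| ≤ |A|. (5.5) Proof. This follows from Lemma 5.1 and Lemma 1.0.» — PROVED for EVERY `A` from the
normalisation Lemma 1.0 on some radius `ρ > 0` and the one-parameter-subgroup property `e^A = (e^{A/m})^m` of the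
exponential map (the step print leaves implicit: split `A` into `m` pieces of size `< ρ`, apply Lemma 1.0 to each and
Lemma 5.1 `m − 1` times, `abs_pow_le`). [cite: Federbush1987PhaseCellIII, Lemma 5.2 (5.5) p. 299] -/
theorem abs_exp_le_norm (exp : 𝔤 → G) {ρ : ℝ} (hρ : 0 < ρ) (h10 : Lemma10Normalisation exp ρ)
    (hline : ∀ (A : 𝔤) (m : ℕ), 0 < m → exp A = exp ((m : ℝ)⁻¹ • A) ^ m) (A : 𝔤) :
    absG (exp A) ≤ ‖A‖ := by
  -- choose m with ‖A‖ / m < ρ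
  obtain ⟨m, hm⟩ := exists_nat_gt (‖A‖ / ρ)
  have hmpos : 0 < m := by
    rcases Nat.eq_zero_or_pos m with h | h
    · subst h; simp at hm; exact absurd hm (not_lt.mpr (div_nonneg (norm_nonneg _) hρ.le))
    · exact h
  have hmR : (0 : ℝ) < m := by exact_mod_cast hmpos
  have hsmall : ‖(m : ℝ)⁻¹ • A‖ < ρ := by
    rw [norm_smul, norm_inv, Real.norm_natCast]
    rw [div_lt_iff₀ hρ] at hm
    rw [inv_mul_lt_iff₀ hmR]
    linarith [mul_comm ρ (m : ℝ)]
  rw [hline A m hmpos]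
  calc absG (exp ((m : ℝ)⁻¹ • A) ^ m) ≤ m * absG (exp ((m : ℝ)⁻¹ • A)) := abs_pow_le _ _
    _ = m * ‖(m : ℝ)⁻¹ • A‖ := by rw [h10 _ hsmall]
    _ = ‖A‖ := by rw [norm_smul, norm_inv, Real.norm_natCast]; field_simp

end LieData

/-! ## §5.2 — Parameter Conditions 5.7, 5.8 and Proposition 5.9 (p. 301–302) -/

section Regime1Parameters

/-- **Parameter Conditions 5.7** «c_d = 600. (5.14) We here and elsewhere are vastly over-generous in choice of constants,
to accomodate worst case scenarios arising in estimates from Sects. 5.3 and 5.4.» (`c_d` is the constant of the modified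
distance `d_M` (3.6), see `Federbush1986/LocalStability`). [cite: Federbush1987PhaseCellIII, Parameter Conditions 5.7
(5.14) p. 301] -/
def ParameterCondition57 (c_d : ℝ) : Prop := c_d = 600

/-- **Parameter Condition 5.8** «4000(N − 1)Na < ε₁, (5.15) where ε₁ is sufficiently small so that the estimates in Sect. 1
hold and so that one has the following proposition» (Proposition 5.9).  `N` = block side, `a` = small-field threshold.
[cite: Federbush1987PhaseCellIII, Parameter Condition 5.8 (5.15) p. 301] -/
def ParameterCondition58 (N : ℕ) (a ε₁ : ℝ) : Prop := 4000 * ((N : ℝ) - 1) * N * a < ε₁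

variable (G : Type*) [Group G] [MetricSpace G]

/-- **Proposition 5.9** at a given `ε₁`: «Let g_i be n elements of the group G, then d(g_i, g_j) < ε₁ ⇒ d(ḡ, g_i) < ε₁.
(5.16)» (`ḡ` the average of the `g_i`; «It is an easy geometric exercise to show this holds for ε₁ small enough.», p. 302).
TYPED over pure-average minimisers (1.2) — in Regime 1 «(3.8) and (1.2) yield the same result when the g_i are
sufficiently close together» (p. 298). [cite: Federbush1987PhaseCellIII, Proposition 5.9 (5.16) p. 301] -/
def Proposition59At (ε₁ : ℝ) : Prop :=
  ∀ (n : ℕ) (gs : Fin n → G) (gbar : G), IsPureAverage gs gbar →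
    (∀ i j, dist (gs i) (gs j) < ε₁) → ∀ i, dist gbar (gs i) < ε₁

/-- Proposition 5.9 as asserted: it «holds for ε₁ small enough» (p. 302, first line) — for the printed setting (compact Lie
group, invariant Riemannian distance). [cite: Federbush1987PhaseCellIII, Proposition 5.9 (5.16) p. 301–302] -/
def Proposition59 : Prop := ∃ ε₀ > (0 : ℝ), ∀ ε₁ : ℝ, 0 < ε₁ → ε₁ ≤ ε₀ → Proposition59At G ε₁

end Regime1Parameters

end Literature.MathematicalPhysics.QuantumFieldTheory.Federbush1986
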